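import Summits.ValiantsHypothesis.ValiantsHypothesis.Theorems.EquivariantDialPolyIndex
import Literature.Computability.AlgebraicComplexity.DeterminantalComplexityProofs
import HarnessLib

/-!
# The HEAD LEMMA — principal-block HEREDITY of equivariant hardness (lens-1 g34)

Fourth engine for the dial `W ⟺ EqHard H ∧ SymCheap H` of `EquivariantDialNode` (after ORDER g21,
Hessian-rank g21–g24, INDEX g33); none of those compares notches of DIFFERENT matrix sizes — this does.

## Engine (§1–§2), law (§3), instances (§4)

* `isEquivariantDetRepr_transport` (§1, any commutative ring): an exactly `Γ`-equivariant affine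
  representation `A` of `f` is carried to an exactly `Γ'`-equivariant one `A.map φ` of `φ f`, SAME
  size, by any algebra map `φ` keeping entries affine and INTERTWINING the actions (`φ ∘ γ = γ' ∘ φ`
  for some `γ ∈ Γ` above each `γ' ∈ Γ'`); the lifts are reused.
* `headSubst n b` (§2) is the principal-block substitution `X ↦ (X 0; 0 1_b)`:
  `per_{n+b}(X 0; 0 1) = per_n(X)` (`aeval_headSubst_perPoly`); for head permutations `(σ, τ)`
  extended by the identity on the tail (`headExt`) it intertwines `x ↦ x_{σ̂ i, τ̂ j}` with
  `x ↦ x_{σ i, τ j}` (`aeval_headSubst_comp_linSubst`), so an equivariant representation of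
  `per_{n+b}` RESTRICTS to one of `per_n` of the same size (`hasEquivariantDetRepr_head`).
* `eqHard_of_heredity` (§3): if the tail-identity extension of `K' n` to the p-bounded size
  `n + b n` lands in `K (n + b n)` for all `n`, then `EqHard K' → EqHard K`
  (`polyEquivariant_of_heredity`: polynomial equivariant families restrict to heads).
* §4 (previously UNDECIDED on the dial map; unreachable by the g33 index law, the index below `Δ𝔖_m`
  being `≥ (m choose t(m))`): for every polynomially co-final head size `t` (`⌊m/2⌋`, `⌊√m⌋`) the
  diagonal HEAD `Δ(𝔖_{t(m)} ⊕ 1)` (`eqHard_diagHead`, `_half`, `_sqrt` — a group of order `⌊√m⌋!`),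
  the YOUNG subgroups of the diagonal `Δ(𝔖_{<t} × 𝔖_{≥t})` (`eqHard_diagYoung`, census W36) and the
  CORNER (`eqHard_biHead`) are HARD; ★ `eqHard_rowHead_iff` (`_sqrt_iff`): ROW-HEAD hard IFF P-ROW.

## HONEST BOUNDARY (K5)

HONEST BOUNDARY: 0 S-currency; closes NO item; every hardness in this file is S-implied (S ⇒ W ⇒
EqHard H) and rests on eqHard_diag (LR17 Thm 2 route, O-L1-23); P-ROW (EqHard rowSubst ⟺ EqHard
rowAltSubst) is RELOCATED by eqHard_rowHead_iff, NOT decided, and stays UNDECIDED · IDEA-NEEDED —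
heredity never creates column motion; heads of bounded size are costumes of W (g21/g33, not
re-kernelled); the window c < t(m) < m^{o(1)} and the cyclic notches are NOT claimed; stmt-23702 /
VP ≠ VNP untouched.

* DELTA vs tree: `FreeSubtorus…SacrificeLifts.isEquivariantDetRepr_subst_const` transports
  equivariance along a CONSTANT substitution for diagonal tori only; `PermanentMonotone.padSubst`
  pads the permanent with NO group bookkeeping; `EquivariantDialInduction` compares groups at the
  SAME size.  Size-changing equivariant restriction is new in the tree.
* DELTA vs literature: [LandsbergRessayre2017, §1, Question 2.2] / Landsberg 2017 §7.4.1 vary the group at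
  FIXED `m`; the restriction functor `per_{n+b} ↦ per_n` is unrecorded in our corpus + galaxy searches.
* Reused BY NAME (no re-proofs): `eqHard_diag`, `EqHard.mono`, `PolyEquivariant.anti`, `diagPermSubst_eq_map`,
  `biPermHom`/`coe_biPermHom`/`diagHom`, `rowSubst`, `IsPBounded.comp_holds`/`add_holds`/`id`, `linSubst_permMatrix`,
  `HasDetRepr.totalDegree_aeval_le_of_le_one`, `permanent_fromBlocks_zero₂₁`, `permanent_submatrix_equiv`.
-/

set_option linter.dupNamespace false

noncomputable section

namespace Summit.ValiantsHypothesis.ValiantsHypothesis.Theorems.EquivariantDialPolyIndex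

open MvPolynomial Matrix Literature.Computability.AlgebraicComplexity
open Summit.ValiantsHypothesis.ValiantsHypothesis.Theorems.EquivariantDialNode
open Summit.ValiantsHypothesis.ValiantsHypothesis.Theorems.EquivariantDialDiagonalPermify
  (diagPermSubst)
open Summit.ValiantsHypothesis.ValiantsHypothesis.Theorems.EquivariantDialDiagonalNotQP (eqHard_diag)

/-! ### §1 The transport engine -/

/-- ★ ENGINE.  Exact equivariance is transported along any algebra map `φ` that keeps the entries
affine and intertwines the actions (`φ ∘ γ = γ' ∘ φ`, one `γ ∈ Γ` above each `γ' ∈ Γ'`): the image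
matrix `A.map φ` represents `φ f`, has the same size, and the old lifts `(g, h)` still work.
[folklore; cf. LandsbergRessayre2017, Def. 1.3] -/
theorem isEquivariantDetRepr_transport {k : Type*} [CommRing k] {σ τ : Type*} [Fintype σ]
    [DecidableEq σ] [Fintype τ] [DecidableEq τ] {Γ : Subgroup (GL σ k)} {Γ' : Subgroup (GL τ k)}
    {f : MvPolynomial σ k} {s : ℕ} {A : Matrix (Fin s) (Fin s) (MvPolynomial σ k)}
    (hA : IsEquivariantDetRepr Γ f A) (φ : MvPolynomial σ k →ₐ[k] MvPolynomial τ k)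
    (hφ : ∀ i j, (φ (A i j)).totalDegree ≤ 1)
    (hint : ∀ γ' ∈ Γ', ∃ γ ∈ Γ, φ.comp (linSubst σ k (γ : Matrix σ σ k)) =
      (linSubst τ k (γ' : Matrix τ τ k)).comp φ) :
    IsEquivariantDetRepr Γ' (φ f) (A.map φ) := by
  refine ⟨⟨fun i j => hφ i j, ?_⟩, fun γ' hγ' => ?_⟩
  · rw [← AlgHom.mapMatrix_apply, ← AlgHom.map_det, hA.1.2]
  · obtain ⟨γ, hγ, hcomm⟩ := hint γ' hγ'
    obtain ⟨g, h, hgh⟩ := hA.2 γ hγ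
    have hC : ∀ M : Matrix (Fin s) (Fin s) k,
        (M.map C : Matrix (Fin s) (Fin s) (MvPolynomial σ k)).map φ = M.map C := by
      intro M
      rw [Matrix.map_map]
      congr 1
      funext a
      simp only [Function.comp_apply, MvPolynomial.algHom_C, MvPolynomial.algebraMap_eq]
    refine ⟨g, h, ?_⟩
    calc Matrix.linSubstEntries γ' (A.map φ)
        = (Matrix.linSubstEntries γ A).map φ := by
          simp only [Matrix.linSubstEntries, Matrix.map_map]
          congr 1
          funext p
          exact (AlgHom.congr_fun hcomm p).symm
      _ = (g : Matrix (Fin s) (Fin s) k).map C * A.map φ *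
            ((h⁻¹ : GL (Fin s) k) : Matrix (Fin s) (Fin s) k).map C := by
          rw [hgh, Matrix.map_mul, Matrix.map_mul, hC, hC]

/-! ### §2 The head substitution `X ↦ (X 0; 0 1)` and its intertwining -/

/-- The HEAD SUBSTITUTION on the variables of the `(n+b) × (n+b)` generic matrix: the principal
`n × n` block keeps its variables, the tail diagonal becomes `1`, everything else `0`. [folklore] -/
def headSubst (n b : ℕ) : Fin (n + b) × Fin (n + b) → MvPolynomial (Fin n × Fin n) ℂ := fun p =>
  Sum.elim (fun i => Sum.elim (fun j => X (i, j)) (fun _ => 0) (finSumFinEquiv.symm p.2))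
    (fun i => Sum.elim (fun _ => 0) (fun j => if i = j then 1 else 0) (finSumFinEquiv.symm p.2))
    (finSumFinEquiv.symm p.1)

/-- Head/head entries are the variables. [folklore] -/
theorem headSubst_castAdd_castAdd (n b : ℕ) (i j : Fin n) :
    headSubst n b (Fin.castAdd b i, Fin.castAdd b j) = X (i, j) := by
  simp [headSubst]

/-- Head/tail entries vanish. [folklore] -/
theorem headSubst_castAdd_natAdd (n b : ℕ) (i : Fin n) (j : Fin b) :
    headSubst n b (Fin.castAdd b i, Fin.natAdd n j) = 0 := by
  simp [headSubst]

/-- Tail/head entries vanish. [folklore] -/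
theorem headSubst_natAdd_castAdd (n b : ℕ) (i : Fin b) (j : Fin n) :
    headSubst n b (Fin.natAdd n i, Fin.castAdd b j) = 0 := by
  simp [headSubst]

/-- Tail/tail entries are the identity matrix. [folklore] -/
theorem headSubst_natAdd_natAdd (n b : ℕ) (i j : Fin b) :
    headSubst n b (Fin.natAdd n i, Fin.natAdd n j) = if i = j then 1 else 0 := by
  simp [headSubst]

/-- The head substitution is affine (its values are variables, `0` or `1`). [folklore] -/
theorem totalDegree_headSubst_le (n b : ℕ) (p : Fin (n + b) × Fin (n + b)) :
    (headSubst n b p).totalDegree ≤ 1 := by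
  obtain ⟨p₁, p₂⟩ := p
  induction p₁ using Fin.addCases <;> induction p₂ using Fin.addCases
  · rw [headSubst_castAdd_castAdd]
    exact (totalDegree_X _).le
  · simp [headSubst_castAdd_natAdd]
  · simp [headSubst_natAdd_castAdd]
  · rw [headSubst_natAdd_natAdd]
    split_ifs <;> simp

/-- The substituted generic matrix is the block matrix `(X 0; 0 1)`. [folklore] -/
theorem of_headSubst_eq (n b : ℕ) :
    (Matrix.of fun i j : Fin (n + b) => headSubst n b (i, j)) =
      (Matrix.fromBlocks (mvPolynomialX (Fin n) (Fin n) ℂ) 0 0 1).submatrix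
        finSumFinEquiv.symm finSumFinEquiv.symm := by
  ext i j
  induction i using Fin.addCases <;> induction j using Fin.addCases
  · simp [headSubst_castAdd_castAdd, mvPolynomialX_apply]
  · simp [headSubst_castAdd_natAdd]
  · simp [headSubst_natAdd_castAdd]
  · simp [headSubst_natAdd_natAdd, Matrix.one_apply]

/-- **`per_{n+b}(X 0; 0 1) = per_n(X)`.** [folklore; cf. Burgisser2000, Def. 2.6] -/
theorem aeval_headSubst_perPoly (n b : ℕ) :
    aeval (headSubst n b) (perPoly (Fin (n + b)) ℂ) = perPoly (Fin n) ℂ := by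
  have h1 : aeval (headSubst n b) (perPoly (Fin (n + b)) ℂ) =
      (Matrix.of fun i j : Fin (n + b) => headSubst n b (i, j)).permanent := by
    simp [perPoly, Matrix.permanent, map_sum, map_prod]
  rw [h1, of_headSubst_eq, permanent_submatrix_equiv, permanent_fromBlocks_zero₂₁,
    Matrix.permanent_one, mul_one]
  rfl

/-- Extension of a head permutation of `Fin n` to `Fin (n + b)` by the identity on the tail.
[folklore] -/
def headExt (n b : ℕ) : Equiv.Perm (Fin n) →* Equiv.Perm (Fin (n + b)) :=
  Equiv.Perm.viaEmbeddingHom (Fin.castAddEmb b)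

/-- The extension acts on the head as the original permutation. [folklore] -/
theorem headExt_castAdd (n b : ℕ) (σ : Equiv.Perm (Fin n)) (i : Fin n) :
    headExt n b σ (Fin.castAdd b i) = Fin.castAdd b (σ i) := by
  unfold headExt
  rw [Equiv.Perm.viaEmbeddingHom_apply]
  exact Equiv.Perm.viaEmbedding_apply σ (Fin.castAddEmb b) i

/-- The extension fixes the tail. [folklore] -/
theorem headExt_natAdd (n b : ℕ) (σ : Equiv.Perm (Fin n)) (j : Fin b) :
    headExt n b σ (Fin.natAdd n j) = Fin.natAdd n j := by
  unfold headExt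
  rw [Equiv.Perm.viaEmbeddingHom_apply]
  refine Equiv.Perm.viaEmbedding_apply_of_notMem σ (Fin.castAddEmb b) _ ?_
  rintro ⟨i, hi⟩
  have h := congrArg Fin.val hi
  simp only [Fin.castAddEmb_apply, Fin.val_castAdd, Fin.val_natAdd] at h
  have := i.isLt
  omega

/-- A pair of permutations acts on the variables by `x_{ij} ↦ x_{α i, β j}`. [folklore] -/
theorem linSubst_biPermHom_X (m : ℕ) (α β : Equiv.Perm (Fin m)) (i j : Fin m) :
    linSubst (Fin m × Fin m) ℂ ((biPermHom m (α, β) : GL (Fin m × Fin m) ℂ) :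
      Matrix (Fin m × Fin m) (Fin m × Fin m) ℂ) (X (i, j)) = X (α i, β j) := by
  have h : ((Equiv.prodCongr α⁻¹ β⁻¹).symm : Fin m × Fin m ≃ Fin m × Fin m) (i, j) = (α i, β j) :=
    rfl
  rw [coe_biPermHom, linSubst_permMatrix, rename_X, h]

/-- ★ INTERTWINING.  Substituting the head after permuting the big matrix by the tail-identity
extensions `(σ̂, τ̂)` equals permuting the head by `(σ, τ)` after substituting. [folklore] -/
theorem aeval_headSubst_comp_linSubst (n b : ℕ) (σ τ : Equiv.Perm (Fin n)) :
    (aeval (headSubst n b)).comp (linSubst (Fin (n + b) × Fin (n + b)) ℂ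
        ((biPermHom (n + b) (headExt n b σ, headExt n b τ) : GL (Fin (n + b) × Fin (n + b)) ℂ) :
          Matrix (Fin (n + b) × Fin (n + b)) (Fin (n + b) × Fin (n + b)) ℂ)) =
      (linSubst (Fin n × Fin n) ℂ ((biPermHom n (σ, τ) : GL (Fin n × Fin n) ℂ) :
          Matrix (Fin n × Fin n) (Fin n × Fin n) ℂ)).comp (aeval (headSubst n b)) := by
  apply MvPolynomial.algHom_ext
  rintro ⟨p₁, p₂⟩
  simp only [AlgHom.comp_apply, linSubst_biPermHom_X, aeval_X]
  induction p₁ using Fin.addCases <;> induction p₂ using Fin.addCases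
  · rw [headExt_castAdd, headExt_castAdd, headSubst_castAdd_castAdd, headSubst_castAdd_castAdd,
      linSubst_biPermHom_X]
  · rw [headExt_castAdd, headExt_natAdd, headSubst_castAdd_natAdd, headSubst_castAdd_natAdd,
      map_zero]
  · rw [headExt_natAdd, headExt_castAdd, headSubst_natAdd_castAdd, headSubst_natAdd_castAdd,
      map_zero]
  · rw [headExt_natAdd, headExt_natAdd, headSubst_natAdd_natAdd]
    split_ifs
    · rw [map_one]
    · rw [map_zero]

/-- ★ HEAD RESTRICTION.  An equivariant affine representation of `per_{n+b}` for a group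
containing the tail-identity extensions of `K ≤ 𝔖_n × 𝔖_n` restricts, by the head substitution,
to a `K`-equivariant affine representation of `per_n` OF THE SAME SIZE.
[folklore; cf. LandsbergRessayre2017, §1] -/
theorem hasEquivariantDetRepr_head (n b : ℕ) {s : ℕ}
    (K : Subgroup (Equiv.Perm (Fin n) × Equiv.Perm (Fin n)))
    {Γ : Subgroup (GL (Fin (n + b) × Fin (n + b)) ℂ)}
    (hK : (K.map ((headExt n b).prodMap (headExt n b))).map (biPermHom (n + b)) ≤ Γ)
    (h : HasEquivariantDetRepr Γ (perPoly (Fin (n + b)) ℂ) s) :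
    HasEquivariantDetRepr (K.map (biPermHom n)) (perPoly (Fin n) ℂ) s := by
  obtain ⟨A, hA⟩ := h
  refine ⟨A.map (aeval (headSubst n b)), ?_⟩
  rw [← aeval_headSubst_perPoly n b]
  refine isEquivariantDetRepr_transport hA (aeval (headSubst n b)) (fun i j => ?_) ?_
  · exact (HasDetRepr.totalDegree_aeval_le_of_le_one _ (totalDegree_headSubst_le n b) _).trans
      (hA.1.1 i j)
  · rintro γ' hγ'
    obtain ⟨⟨σ, τ⟩, hστ, rfl⟩ := Subgroup.mem_map.mp hγ'
    exact ⟨biPermHom (n + b) (headExt n b σ, headExt n b τ),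
      hK (Subgroup.mem_map.mpr ⟨(headExt n b σ, headExt n b τ),
        Subgroup.mem_map.mpr ⟨(σ, τ), hστ, rfl⟩, rfl⟩),
      aeval_headSubst_comp_linSubst n b σ τ⟩

/-! ### §3 The heredity law -/

variable {K : ∀ m : ℕ, Subgroup (Equiv.Perm (Fin m) × Equiv.Perm (Fin m))}
  {K' : ∀ n : ℕ, Subgroup (Equiv.Perm (Fin n) × Equiv.Perm (Fin n))}

/-- HEREDITY, existence side: a polynomial equivariant family for the notch family `K` RESTRICTS
to one for any notch family `K'` whose tail-identity extensions (to a polynomially larger size)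
land inside `K`. [folklore; cf. LandsbergRessayre2017, Question 2.2] -/
theorem polyEquivariant_of_heredity (b : ℕ → ℕ) (hb : IsPBounded fun n => n + b n)
    (hK : ∀ n, (K' n).map ((headExt n (b n)).prodMap (headExt n (b n))) ≤ K (n + b n))
    (h : PolyEquivariant fun m => (K m).map (biPermHom m)) :
    PolyEquivariant fun n => (K' n).map (biPermHom n) := by
  obtain ⟨c, hc⟩ := h
  obtain ⟨c', hc'⟩ :=
    IsPBounded.comp_holds (⟨c, fun _ => le_rfl⟩ : IsPBounded fun m : ℕ => m ^ c + c) hb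
  refine ⟨c', fun n => ?_⟩
  obtain ⟨s, hs, hA⟩ := hc (n + b n)
  exact ⟨s, hs.trans (hc' n),
    hasEquivariantDetRepr_head n (b n) (K' n) (Subgroup.map_mono (hK n)) hA⟩

/-- ★★ THE HEREDITY LAW (hardness side): equivariant hardness at `K'` is INHERITED by every
notch family `K` that contains, at a polynomially larger size, the tail-identity extensions of
`K'`. [folklore; cf. LandsbergRessayre2017, Question 2.2] -/
theorem eqHard_of_heredity (b : ℕ → ℕ) (hb : IsPBounded fun n => n + b n)
    (hK : ∀ n, (K' n).map ((headExt n (b n)).prodMap (headExt n (b n))) ≤ K (n + b n))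
    (h : EqHard fun n => (K' n).map (biPermHom n)) :
    EqHard fun m => (K m).map (biPermHom m) :=
  fun hP => h (polyEquivariant_of_heredity b hb hK hP)

/-! ### §4 Instances: heads, Young subgroups of the diagonal, corners, row heads -/

/-- The permutations of `Fin m` fixing every index `≥ t` (the head group `𝔖_t ⊕ 1_{m-t}`,
for `t ≤ m`). [folklore] -/
def headPerms (m t : ℕ) : Subgroup (Equiv.Perm (Fin m)) where
  carrier := {σ | ∀ i : Fin m, t ≤ (i : ℕ) → σ i = i}
  mul_mem' := fun {σ τ} hσ hτ i hi => by rw [Equiv.Perm.mul_apply, hτ i hi, hσ i hi]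
  one_mem' := fun i _ => rfl
  inv_mem' := fun {σ} hσ i hi => by rw [Equiv.Perm.inv_def, Equiv.symm_apply_eq]; exact (hσ i hi).symm

/-- The YOUNG subgroup `𝔖_{<t} × 𝔖_{≥t}` of `𝔖_m`: permutations preserving the cut at `t`.
[folklore] -/
def youngPerms (m t : ℕ) : Subgroup (Equiv.Perm (Fin m)) where
  carrier := {σ | ∀ i : Fin m, t ≤ (σ i : ℕ) ↔ t ≤ (i : ℕ)}
  mul_mem' := fun {σ τ} hσ hτ i => by rw [Equiv.Perm.mul_apply, hσ, hτ]
  one_mem' := fun _ => Iff.rfl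
  inv_mem' := fun {σ} hσ i => by rw [← hσ (σ⁻¹ i), Equiv.Perm.inv_def, Equiv.apply_symm_apply]

/-- `𝔖_t ⊕ 1 ≤ 𝔖_{<t} × 𝔖_{≥t}`. [folklore] -/
theorem headPerms_le_youngPerms (m t : ℕ) : headPerms m t ≤ youngPerms m t := by
  intro σ hσ i
  by_cases hi : t ≤ (i : ℕ)
  · rw [hσ i hi]
  · refine ⟨fun h => ?_, fun h => absurd h hi⟩
    exfalso
    have h' : σ (σ i) = σ i := hσ (σ i) h
    exact hi (by rw [← σ.injective h']; exact h)

/-- Tail-identity extensions of head permutations fix every index `≥ t` once `n ≤ t`. [folklore] -/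
theorem headExt_mem_headPerms (n b : ℕ) {t : ℕ} (ht : n ≤ t) (σ : Equiv.Perm (Fin n)) :
    headExt n b σ ∈ headPerms (n + b) t := by
  intro i hi
  have hi' : n ≤ (i : ℕ) := ht.trans hi
  have hlt := i.isLt
  obtain ⟨j, rfl⟩ : ∃ j : Fin b, Fin.natAdd n j = i :=
    ⟨⟨i - n, by omega⟩, Fin.ext (by simp only [Fin.val_natAdd]; omega)⟩
  exact headExt_natAdd n b σ j

/-- DIAGONAL HEAD notch `Δ(𝔖_{t(m)} ⊕ 1)`: `x_{ij} ↦ x_{σ i, σ j}`, `σ` moving only indices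
`< t m`. -/
def diagHeadSubst (t : ℕ → ℕ) (m : ℕ) : Subgroup (GL (Fin m × Fin m) ℂ) :=
  ((headPerms m (t m)).map (diagHom m)).map (biPermHom m)

/-- YOUNG-DIAGONAL notch `Δ(𝔖_{<t(m)} × 𝔖_{≥t(m)})`. -/
def diagYoungSubst (t : ℕ → ℕ) (m : ℕ) : Subgroup (GL (Fin m × Fin m) ℂ) :=
  ((youngPerms m (t m)).map (diagHom m)).map (biPermHom m)

/-- CORNER notch `(𝔖_{t(m)} ⊕ 1) × (𝔖_{t(m)} ⊕ 1)`: independent head row and head column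
permutations. -/
def biHeadSubst (t : ℕ → ℕ) (m : ℕ) : Subgroup (GL (Fin m × Fin m) ℂ) :=
  ((headPerms m (t m)).prod (headPerms m (t m))).map (biPermHom m)

/-- ROW-HEAD notch `(𝔖_{t(m)} ⊕ 1) × 1`: permutations of the first `t m` rows only. -/
def rowHeadSubst (t : ℕ → ℕ) (m : ℕ) : Subgroup (GL (Fin m × Fin m) ℂ) :=
  ((headPerms m (t m)).prod ⊥).map (biPermHom m)

/-- ★ DIAGONAL HEADS ARE HARD: for any polynomially co-final head size `t`
(`n ≤ t (n + b n)`, `n + b n` p-bounded), `per_m` has no polynomial `Δ(𝔖_{t(m)} ⊕ 1)`-equivariant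
family.  Rests on `eqHard_diag` (`EqHard Δ𝔖`, LR17 Thm 2 route); `S`-implied.
[cite: LandsbergRessayre2017, Thm. 2] -/
theorem eqHard_diagHead {t : ℕ → ℕ} (b : ℕ → ℕ) (hb : IsPBounded fun n => n + b n)
    (ht : ∀ n, n ≤ t (n + b n)) : EqHard (diagHeadSubst t) := by
  have hΔ : EqHard fun n => ((⊤ : Subgroup (Equiv.Perm (Fin n))).map (diagHom n)).map
      (biPermHom n) := by
    have e : (fun n => ((⊤ : Subgroup (Equiv.Perm (Fin n))).map (diagHom n)).map
        (biPermHom n)) = diagPermSubst := funext fun n => (diagPermSubst_eq_map n).symm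
    rw [e]
    exact eqHard_diag
  refine eqHard_of_heredity (K' := fun n => (⊤ : Subgroup (Equiv.Perm (Fin n))).map (diagHom n))
    (K := fun m => (headPerms m (t m)).map (diagHom m)) b hb (fun n => ?_) hΔ
  rintro _ ⟨_, ⟨σ, -, rfl⟩, rfl⟩
  exact ⟨headExt n (b n) σ, headExt_mem_headPerms n (b n) (ht n) σ, rfl⟩

/-- `Δ(𝔖_{⌊m/2⌋} ⊕ 1)` is HARD. [cite: LandsbergRessayre2017, Thm. 2] -/
theorem eqHard_diagHead_half : EqHard (diagHeadSubst fun m => m / 2) :=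
  eqHard_diagHead (fun n => n) (IsPBounded.add_holds IsPBounded.id IsPBounded.id)
    (fun n => by show n ≤ (n + n) / 2; omega)

/-- `Δ(𝔖_{⌊√m⌋} ⊕ 1)` is HARD — a head group of order `⌊√m⌋!`. [cite: LandsbergRessayre2017, Thm. 2] -/
theorem eqHard_diagHead_sqrt : EqHard (diagHeadSubst Nat.sqrt) :=
  eqHard_diagHead (fun n => n * n - n)
    ⟨2, fun n => by
      show n + (n * n - n) ≤ n ^ 2 + 2
      rw [Nat.add_sub_cancel' (Nat.le_mul_self n), pow_two]
      exact Nat.le_add_right _ _⟩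
    (fun n => le_of_eq (by
      show n = Nat.sqrt (n + (n * n - n))
      rw [Nat.add_sub_cancel' (Nat.le_mul_self n), Nat.sqrt_eq]))

/-- ★ YOUNG SUBGROUPS OF THE DIAGONAL ARE HARD (census W36), for co-final `t`.
[cite: LandsbergRessayre2017, Thm. 2] -/
theorem eqHard_diagYoung {t : ℕ → ℕ} (b : ℕ → ℕ) (hb : IsPBounded fun n => n + b n)
    (ht : ∀ n, n ≤ t (n + b n)) : EqHard (diagYoungSubst t) :=
  (eqHard_diagHead b hb ht).mono fun m =>
    Subgroup.map_mono (Subgroup.map_mono (headPerms_le_youngPerms m (t m)))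

/-- ★ CORNERS ARE HARD: `(𝔖_{t(m)} ⊕ 1) × (𝔖_{t(m)} ⊕ 1)` for co-final `t`.
[cite: LandsbergRessayre2017, Thm. 2] -/
theorem eqHard_biHead {t : ℕ → ℕ} (b : ℕ → ℕ) (hb : IsPBounded fun n => n + b n)
    (ht : ∀ n, n ≤ t (n + b n)) : EqHard (biHeadSubst t) :=
  (eqHard_diagHead b hb ht).mono fun m => Subgroup.map_mono (by
    rintro _ ⟨σ, hσ, rfl⟩
    exact Subgroup.mem_prod.mpr ⟨hσ, hσ⟩)

/-- ★ P-ROW RELOCATED: the row-head notch `(𝔖_{t(m)} ⊕ 1) × 1` is hard IFF P-ROW, for every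
polynomially co-final head size `t`.  (Does NOT decide P-ROW.) [cite: LandsbergRessayre2017, §1] -/
theorem eqHard_rowHead_iff {t : ℕ → ℕ} (b : ℕ → ℕ) (hb : IsPBounded fun n => n + b n)
    (ht : ∀ n, n ≤ t (n + b n)) : EqHard (rowHeadSubst t) ↔ EqHard rowSubst := by
  refine ⟨fun h => h.mono fun m => Subgroup.map_mono (Subgroup.prod_mono le_top le_rfl),
    fun h => ?_⟩
  refine eqHard_of_heredity (K' := fun n => (⊤ : Subgroup (Equiv.Perm (Fin n))).prod ⊥)
    (K := fun m => (headPerms m (t m)).prod ⊥) b hb (fun n => ?_) h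
  rintro _ ⟨⟨σ, τ⟩, hστ, rfl⟩
  obtain rfl : τ = 1 := Subgroup.mem_bot.mp (Subgroup.mem_prod.mp hστ).2
  exact Subgroup.mem_prod.mpr ⟨headExt_mem_headPerms n (b n) (ht n) σ,
    by show headExt n (b n) 1 ∈ (⊥ : Subgroup _); rw [map_one]; exact Subgroup.one_mem _⟩

/-- P-ROW is equivalent to its `√m`-row germ. [cite: LandsbergRessayre2017, §1] -/
theorem eqHard_rowHead_sqrt_iff : EqHard (rowHeadSubst Nat.sqrt) ↔ EqHard rowSubst :=
  eqHard_rowHead_iff (fun n => n * n - n)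
    ⟨2, fun n => by
      show n + (n * n - n) ≤ n ^ 2 + 2
      rw [Nat.add_sub_cancel' (Nat.le_mul_self n), pow_two]
      exact Nat.le_add_right _ _⟩
    (fun n => le_of_eq (by
      show n = Nat.sqrt (n + (n * n - n))
      rw [Nat.add_sub_cancel' (Nat.le_mul_self n), Nat.sqrt_eq]))

end Summit.ValiantsHypothesis.ValiantsHypothesis.Theorems.EquivariantDialPolyIndex

end
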